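import Summits.RiemannHypothesis.RiemannHypothesis.Theorems.SignConeConeMagnificationTranslate
import Literature.NumberTheory.LFunctions.WeilExplicitFormulaProofs
import Literature.NumberTheory.LFunctions.WeilGroundEnergyProofs

/-!
# `ConeMagnification`: a unit-slack weight reproduces the zero oscillation in every smooth window
(route `SignCone`, item stmt-RiemannHypothesis-16303 `ConeMagnification`; HELPER file, `--supports`)

Let `c ≥ 0` have UNIT SLACK against every Weil test (`-‖φ‖₂² ≤ Re (W_ar - P_c)(φ ⋆ φ̃)`), let `g` be a
Weil test, `G = g ⋆ g̃`, `G_x = G(· - x)` its translates and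
`Δ_c(x) := Σₙ (c(n) − Λ(n)) n^{-1/2} (G_x(log n) + G_x(−log n))` the smooth-window DISCREPANCY of the fake
weight from von Mangoldt's (a finite sum: the window sits at `|log n ∓ x| ≤ 2a`).  Writing
`Φ_c(K) = W_ar(K) − P_c(K) + K(0)` (bounded on translates by unit slack,
`norm_fakeForm_weilTranslate_le`, p129765) and `B_g(x) = Σ_ρ m(ρ) ĝ(ρ) conj ĝ(1−ρ̄) e^{(ρ−1/2)x}` for the zero
side of `G_x` (explicit formula for translates, `weilFunctional_weilTranslate`), one has the exact identity

  `Δ_c(x) = B_g(x) + G(−x) − Φ_c(G_x)`                      (`fakeDiscrepancy_eq`),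

hence `|Δ_c(x) − B_g(x)| ≤ Re Φ_c(G) + ‖g‖₂²` for all real `x` (`norm_fakeDiscrepancy_sub_expSum_le`): in
every smooth window a unit-slack weight differs from `Λ` by EXACTLY the zero oscillation `B_g`, up to `O_g(1)`.
Consequences (all unconditional):
* `riemannHypothesis_of_unitSlack_of_bounded_discrepancy`: if some unit-slack weight is `Λ`-like in every
  smooth window (`Δ_c` bounded for every `g`), then RH (bounded `B_g` kills the off-line fibres,
  `BoundedPowerSum.sum_fiber_eq_zero_of_exp_real`, as in `WeilCriterionConverse`);
* `bounded_discrepancy_of_riemannHypothesis`: conversely under RH every unit-slack weight is `Λ`-like in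
  every smooth window (`|B_g(x)| ≤ Σ m(ρ)|P_g(ρ)|` on the line);
* `riemannHypothesis_iff_bounded_discrepancy`: so, GIVEN a unit-slack weight, RH ⟺ its discrepancy from `Λ`
  is bounded in every smooth window.  In the `¬RH` world of the open core (`stub_designOfOffline`, THM X) an
  admissible weight must therefore copy the off-line oscillation `2 Re m(ρ₀)P_g(ρ₀)e^{(ρ₀−1/2)x}` of size
  `e^{(Re ρ₀ − 1/2)x}` in the windows of every test — the window-side companion of the pinch (p136750).
-/

noncomputable section

-- `Summit.RiemannHypothesis.RiemannHypothesis.…` repeats a namespace component by design (D-0017 layout).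
set_option linter.dupNamespace false

open scoped BigOperators ComplexConjugate ArithmeticFunction.vonMangoldt Real Topology
open Complex MeasureTheory Set Filter

namespace Summit.RiemannHypothesis.RiemannHypothesis.Theorems.SignConeConeMagnification

open Literature.NumberTheory.LFunctions
open Literature.NumberTheory.LFunctions.WeilConverse
open Summit.RiemannHypothesis.RiemannHypothesis.Theorems.SignCone

variable {g : ℝ → ℂ}

/-! ## The explicit formula for translates of an autocorrelation kernel -/

/-- `(G_x)^(ρ) = e^{(ρ−1/2)x} P_g(ρ)` for `G = g ⋆ g̃`. [folklore] -/
theorem weilMellin_weilTranslate_weilConv (hg : IsWeilTest g) (x : ℝ) (ρ : ℂ) :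
    weilMellin (weilTranslate (weilConv g (weilReflect g)) x) ρ =
      cexp ((ρ - 1 / 2) * x) * pairCoeff g ρ := by
  rw [weilMellin_weilTranslate, weilMellin_weilQuadratic hg, pairCoeff]

/-- The zero side of a translate converges absolutely: `Σ_ρ ‖m(ρ) (G_x)^(ρ)‖ < ∞`. [folklore] -/
theorem summable_norm_zeroSide_weilTranslate (hg : IsWeilTest g) (x : ℝ) :
    Summable fun ρ : ZetaZeros.riemannZetaNontrivialZeros ↦
      ‖(riemannZetaZeroOrder (ρ : ℂ) : ℂ) * weilMellin (weilTranslate (weilConv g (weilReflect g)) x) ρ‖ := by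
  refine summable_norm_zeroSide_of_le (K := Real.exp (|x| / 2) * weilDecayConst g ^ 2) fun ρ hρ ↦ ?_
  rw [weilMellin_weilTranslate_weilConv hg, norm_mul]
  calc ‖cexp ((ρ - 1 / 2) * x)‖ * ‖pairCoeff g ρ‖
      ≤ Real.exp (|x| / 2) * (weilDecayConst g ^ 2 / (1 + ρ.im ^ 2) ^ 2) :=
        mul_le_mul (norm_cexp_mul_real_le (abs_re_sub_half_le hρ) x) (norm_pairCoeff_le hg hρ)
          (norm_nonneg _) (Real.exp_pos _).le
    _ = Real.exp (|x| / 2) * weilDecayConst g ^ 2 / (1 + ρ.im ^ 2) ^ 2 := by ring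

/-- **The zero side of `G_x` is `B_g(x)`**: `HasWeilZeroSide (G(· − x)) (B_g(x))`. [folklore] -/
theorem hasWeilZeroSide_weilTranslate (hg : IsWeilTest g) (x : ℝ) :
    HasWeilZeroSide (weilTranslate (weilConv g (weilReflect g)) x) (expSum g x) := by
  have h := hasWeilZeroSide_tsum (summable_norm_zeroSide_weilTranslate hg x)
  have e : (∑' ρ : ZetaZeros.riemannZetaNontrivialZeros, (riemannZetaZeroOrder (ρ : ℂ) : ℂ) *
      weilMellin (weilTranslate (weilConv g (weilReflect g)) x) ρ) = expSum g x := by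
    rw [expSum]
    refine tsum_congr fun ρ ↦ ?_
    rw [weilMellin_weilTranslate_weilConv hg]
    ring
  rwa [e] at h

/-- **Explicit formula for translates**: `W(G(· − x)) = B_g(x)` (`W = weilFunctional`, by
`explicit_formula_holds` and uniqueness of the limit). [folklore] -/
theorem weilFunctional_weilTranslate (hg : IsWeilTest g) (x : ℝ) :
    weilFunctional (weilTranslate (weilConv g (weilReflect g)) x) = expSum g x :=
  tendsto_nhds_unique (explicit_formula_holds ((hg.weilConv hg.weilReflect).weilTranslate x))
    (hasWeilZeroSide_weilTranslate hg x)

/-! ## The window discrepancy `Δ_c(x)` of a weight from `Λ` -/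

/-- `P_c(K) − P_Λ(K) = Σₙ (c(n) − Λ(n)) n^{-1/2}(K(log n) + K(−log n))` (both series are finite sums). [folklore] -/
theorem fakePrimeTerm_sub_weilPrimeTerm (c : ℕ → ℝ) {K : ℝ → ℂ} (hK : HasCompactSupport K) :
    (∑' n : ℕ, ((c n : ℝ) : ℂ) / (Real.sqrt n : ℂ) * (K (Real.log n) + K (-Real.log n))) - weilPrimeTerm K =
      ∑' n : ℕ, (((c n - Λ n : ℝ)) : ℂ) / (Real.sqrt n : ℂ) * (K (Real.log n) + K (-Real.log n)) := by
  rw [weilPrimeTerm, ← (summable_fakePrimeTerm c hK).tsum_sub (summable_weilPrimeTerm hK)]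
  refine tsum_congr fun n ↦ ?_
  push_cast
  ring

/-- **The discrepancy identity** `Δ_c(x) = B_g(x) + G(−x) − Φ_c(G_x)`, where
`Φ_c(K) = W_ar(K) − P_c(K) + K(0)`; no hypothesis on `c`. [folklore] -/
theorem fakeDiscrepancy_eq (c : ℕ → ℝ) (hg : IsWeilTest g) (x : ℝ) :
    (∑' n : ℕ, (((c n - Λ n : ℝ)) : ℂ) / (Real.sqrt n : ℂ) *
        (weilTranslate (weilConv g (weilReflect g)) x (Real.log n) +
          weilTranslate (weilConv g (weilReflect g)) x (-Real.log n))) =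
      expSum g x + weilConv g (weilReflect g) (-x) -
        (weilPolarTerm (weilTranslate (weilConv g (weilReflect g)) x) +
          weilArchTerm (weilTranslate (weilConv g (weilReflect g)) x) -
          (∑' n : ℕ, ((c n : ℝ) : ℂ) / (Real.sqrt n : ℂ) *
            (weilTranslate (weilConv g (weilReflect g)) x (Real.log n) +
              weilTranslate (weilConv g (weilReflect g)) x (-Real.log n))) +
          weilTranslate (weilConv g (weilReflect g)) x 0) := by
  have hGt : IsWeilTest (weilTranslate (weilConv g (weilReflect g)) x) :=
    (hg.weilConv hg.weilReflect).weilTranslate x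
  rw [← fakePrimeTerm_sub_weilPrimeTerm c hGt.2, ← weilFunctional_weilTranslate hg x, weilFunctional]
  have e0 : weilTranslate (weilConv g (weilReflect g)) x 0 = weilConv g (weilReflect g) (-x) := by
    simp [weilTranslate]
  rw [e0]
  ring

/-- **A unit-slack weight reproduces the zero oscillation in every smooth window**:
`|Δ_c(x) − B_g(x)| ≤ Re Φ_c(G) + ‖g‖₂²` for every real `x` (`|Φ_c(G_x)| ≤ Re Φ_c(G)` by unit slack,
`norm_fakeForm_weilTranslate_le`; `|G(−x)| ≤ ‖g‖₂²`, `norm_weilConv_weilReflect_le`). [folklore] -/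
theorem norm_fakeDiscrepancy_sub_expSum_le {c : ℕ → ℝ}
    (hU : ∀ φ : ℝ → ℂ, IsWeilTest φ →
      -(∫ t, ‖φ t‖ ^ 2) ≤
        (weilPolarTerm (weilConv φ (weilReflect φ)) + weilArchTerm (weilConv φ (weilReflect φ)) -
          ∑' n : ℕ, ((c n : ℝ) : ℂ) / (Real.sqrt n : ℂ) *
            (weilConv φ (weilReflect φ) (Real.log n) + weilConv φ (weilReflect φ) (-Real.log n))).re)
    (hg : IsWeilTest g) (x : ℝ) :
    ‖(∑' n : ℕ, (((c n - Λ n : ℝ)) : ℂ) / (Real.sqrt n : ℂ) *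
        (weilTranslate (weilConv g (weilReflect g)) x (Real.log n) +
          weilTranslate (weilConv g (weilReflect g)) x (-Real.log n))) - expSum g x‖ ≤
      (weilPolarTerm (weilConv g (weilReflect g)) + weilArchTerm (weilConv g (weilReflect g)) -
          (∑' n : ℕ, ((c n : ℝ) : ℂ) / (Real.sqrt n : ℂ) *
            (weilConv g (weilReflect g) (Real.log n) + weilConv g (weilReflect g) (-Real.log n))) +
          weilConv g (weilReflect g) 0).re + ∫ t, ‖g t‖ ^ 2 := by
  rw [fakeDiscrepancy_eq c hg x, show ∀ B A Φ : ℂ, B + A - Φ - B = A - Φ from fun _ _ _ ↦ by ring]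
  have h1 := norm_fakeForm_weilTranslate_le hU hg x
  have h2 := norm_weilConv_weilReflect_le hg (-x)
  calc _ ≤ ‖weilConv g (weilReflect g) (-x)‖ + ‖weilPolarTerm (weilTranslate (weilConv g (weilReflect g)) x) +
          weilArchTerm (weilTranslate (weilConv g (weilReflect g)) x) -
          (∑' n : ℕ, ((c n : ℝ) : ℂ) / (Real.sqrt n : ℂ) *
            (weilTranslate (weilConv g (weilReflect g)) x (Real.log n) +
              weilTranslate (weilConv g (weilReflect g)) x (-Real.log n))) +
          weilTranslate (weilConv g (weilReflect g)) x 0‖ := norm_sub_le _ _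
    _ ≤ _ := by linarith

/-! ## RH from a `Λ`-like unit-slack weight, and conversely -/

/-- If `B_g` is bounded on `ℝ` then `m(ρ) P_g(ρ) = 0` at every non-trivial zero off the critical line
(the fibre of `ρ ↦ ρ − 1/2` over `ρ₀ − 1/2` is `{ρ₀}`; `BoundedPowerSum.sum_fiber_eq_zero_of_exp_real`).
[folklore] -/
theorem order_mul_pairCoeff_eq_zero_of_bounded (hg : IsWeilTest g) {M : ℝ} (hM : ∀ x : ℝ, ‖expSum g x‖ ≤ M)
    {ρ₀ : ℂ} (hρ₀ : ρ₀ ∈ ZetaZeros.riemannZetaNontrivialZeros) (hre : ρ₀.re ≠ 1 / 2) :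
    (riemannZetaZeroOrder ρ₀ : ℂ) * pairCoeff g ρ₀ = 0 := by
  -- adapted from `WeilCriterionConverse.order_mul_pairCoeff_eq_zero` (bound `M` in place of `Re Q(g)`)
  have h := Literature.Analysis.Complex.BoundedPowerSum.sum_fiber_eq_zero_of_exp_real
    (ι := ZetaZeros.riemannZetaNontrivialZeros)
    (c := fun ρ ↦ (riemannZetaZeroOrder (ρ : ℂ) : ℂ) * pairCoeff g ρ)
    (lam := fun ρ ↦ (ρ : ℂ) - 1 / 2) (R := 1 / 2) (M := M)
    (summable_norm_pairCoeff hg) (fun ρ ↦ abs_re_sub_half_le ρ.2) (fun z ↦ ?_)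
    (fun x ↦ hM x) (μ := ρ₀ - 1 / 2) (by simpa [sub_re] using sub_ne_zero.2 hre)
    {⟨ρ₀, hρ₀⟩} (fun ρ ↦ ?_)
  · simpa using h
  · refine ⟨1, one_pos, ?_⟩
    refine ((riemannZetaNontrivialZeros_finite_inter_ball (z + 1 / 2) 1).preimage
      (Subtype.val_injective.injOn)).subset fun ρ hρ ↦ ?_
    simp only [mem_setOf_eq, Metric.mem_ball, dist_eq_norm] at hρ
    refine ⟨ρ.2, ?_⟩
    rw [Metric.mem_ball, dist_eq_norm]
    rwa [show (ρ : ℂ) - (z + 1 / 2) = (ρ : ℂ) - 1 / 2 - z by ring]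
  · rw [Finset.mem_singleton, sub_left_inj]
    constructor
    · rintro rfl; rfl
    · intro h; exact Subtype.ext h

/-- **RH from a `Λ`-like unit-slack weight.** If `c` has unit slack against every Weil test and its
smooth-window discrepancy from `Λ` is bounded for every test kernel (`sup_x |Δ_c(x)| < ∞` for every Weil
test `g`), then the Riemann hypothesis holds: `B_g = Δ_c − G(−·) + Φ_c(G_·)` is then bounded for every `g`,
so the off-line fibres vanish, and a narrow bump with `Re ĝ > 0` on the horizontal line through `ρ` shows
`Re ρ = 1/2` (`exists_isWeilTest_re_weilMellin_pos`, as in Bombieri's converse). [folklore] -/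
theorem riemannHypothesis_of_unitSlack_of_bounded_discrepancy :
    ∀ c : ℕ → ℝ, (∀ φ : ℝ → ℂ, IsWeilTest φ →
      -(∫ t, ‖φ t‖ ^ 2) ≤
        (weilPolarTerm (weilConv φ (weilReflect φ)) + weilArchTerm (weilConv φ (weilReflect φ)) -
          ∑' n : ℕ, ((c n : ℝ) : ℂ) / (Real.sqrt n : ℂ) *
            (weilConv φ (weilReflect φ) (Real.log n) + weilConv φ (weilReflect φ) (-Real.log n))).re) →
    (∀ g : ℝ → ℂ, IsWeilTest g → ∃ C : ℝ, ∀ x : ℝ,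
      ‖∑' n : ℕ, (((c n - ArithmeticFunction.vonMangoldt n : ℝ)) : ℂ) / (Real.sqrt n : ℂ) *
        (weilTranslate (weilConv g (weilReflect g)) x (Real.log n) +
          weilTranslate (weilConv g (weilReflect g)) x (-Real.log n))‖ ≤ C) →
    RiemannHypothesis := by
  intro c hU hB
  -- `B_g` is bounded for every test `g`
  have hbdd : ∀ g : ℝ → ℂ, IsWeilTest g → ∃ M : ℝ, ∀ x : ℝ, ‖expSum g x‖ ≤ M := by
    intro g hg
    obtain ⟨C, hC⟩ := hB g hg
    refine ⟨C + ((weilPolarTerm (weilConv g (weilReflect g)) + weilArchTerm (weilConv g (weilReflect g)) -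
          (∑' n : ℕ, ((c n : ℝ) : ℂ) / (Real.sqrt n : ℂ) *
            (weilConv g (weilReflect g) (Real.log n) + weilConv g (weilReflect g) (-Real.log n))) +
          weilConv g (weilReflect g) 0).re + ∫ t, ‖g t‖ ^ 2), fun x ↦ ?_⟩
    have h1 := norm_fakeDiscrepancy_sub_expSum_le hU hg x
    have h2 := hC x
    have h3 := norm_sub_le
      (∑' n : ℕ, (((c n - Λ n : ℝ)) : ℂ) / (Real.sqrt n : ℂ) *
        (weilTranslate (weilConv g (weilReflect g)) x (Real.log n) +
          weilTranslate (weilConv g (weilReflect g)) x (-Real.log n)))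
      ((∑' n : ℕ, (((c n - Λ n : ℝ)) : ℂ) / (Real.sqrt n : ℂ) *
        (weilTranslate (weilConv g (weilReflect g)) x (Real.log n) +
          weilTranslate (weilConv g (weilReflect g)) x (-Real.log n))) - expSum g x)
    rw [sub_sub_cancel] at h3
    linarith
  -- every non-trivial zero is on the line (adapted from `WeilCriterionConverse.re_eq_one_half`)
  refine riemannHypothesis_iff_strip_holds.2 fun ρ hs h0 h1 ↦ ?_
  have hρ : ρ ∈ ZetaZeros.riemannZetaNontrivialZeros :=
    ZetaZeros.riemannZetaNontrivialZeros.mem_iff'.2 ⟨hs, h0, h1⟩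
  by_contra hre
  obtain ⟨g, hg, hpos⟩ := exists_isWeilTest_re_weilMellin_pos ρ.im
  obtain ⟨M, hM⟩ := hbdd g hg
  have h := order_mul_pairCoeff_eq_zero_of_bounded hg hM hρ hre
  have hm : (riemannZetaZeroOrder ρ : ℂ) ≠ 0 := by
    have := ZetaZeros.riemannZetaNontrivialZeros.one_le_order hρ
    exact_mod_cast (by omega : riemannZetaZeroOrder ρ ≠ 0)
  have e1 : weilMellin g ρ ≠ 0 := by
    intro h0'
    have := hpos ρ.re
    rw [show (ρ.re : ℂ) + ρ.im * I = ρ from Complex.re_add_im ρ, h0', Complex.zero_re] at this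
    exact lt_irrefl _ this
  have e2 : weilMellin g (1 - conj ρ) ≠ 0 := by
    intro h0'
    have := hpos (1 - ρ.re)
    rw [show ((1 - ρ.re : ℝ) : ℂ) + ρ.im * I = 1 - conj ρ from ?_, h0', Complex.zero_re] at this
    · exact lt_irrefl _ this
    · apply Complex.ext <;> simp
  exact (mul_ne_zero hm (mul_ne_zero e1 ((map_ne_zero _).2 e2))) h

/-- Under RH, `|B_g(x)| ≤ Σ_ρ m(ρ) |P_g(ρ)|` for all real `x` (`|e^{(ρ−1/2)x}| = 1` on the line). [folklore] -/
theorem norm_expSum_le_of_riemannHypothesis (hRH : RiemannHypothesis) (hg : IsWeilTest g) (x : ℝ) :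
    ‖expSum g x‖ ≤ ∑' ρ : ZetaZeros.riemannZetaNontrivialZeros,
      ‖(riemannZetaZeroOrder (ρ : ℂ) : ℂ) * pairCoeff g ρ‖ := by
  have he : ∀ ρ : ZetaZeros.riemannZetaNontrivialZeros, ‖cexp (((ρ : ℂ) - 1 / 2) * x)‖ = 1 := by
    intro ρ
    have hρ : (ρ : ℂ).re = 1 / 2 :=
      (riemannHypothesis_iff_strip_holds.1 hRH) (ρ : ℂ)
        (ZetaZeros.riemannZetaNontrivialZeros.zeta_eq_zero ρ.2)
        (ZetaZeros.riemannZetaNontrivialZeros.re_pos ρ.2) (ZetaZeros.riemannZetaNontrivialZeros.re_lt_one ρ.2)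
    rw [Complex.norm_exp]
    simp [Complex.mul_re, sub_re, hρ]
  have hcongr : (fun ρ : ZetaZeros.riemannZetaNontrivialZeros ↦
      ‖(riemannZetaZeroOrder (ρ : ℂ) : ℂ) * pairCoeff g ρ * cexp (((ρ : ℂ) - 1 / 2) * x)‖) =
      fun ρ : ZetaZeros.riemannZetaNontrivialZeros ↦ ‖(riemannZetaZeroOrder (ρ : ℂ) : ℂ) * pairCoeff g ρ‖ := by
    funext ρ
    rw [norm_mul, he, mul_one]
  rw [expSum]
  calc _ ≤ ∑' ρ : ZetaZeros.riemannZetaNontrivialZeros,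
        ‖(riemannZetaZeroOrder (ρ : ℂ) : ℂ) * pairCoeff g ρ * cexp (((ρ : ℂ) - 1 / 2) * x)‖ :=
        norm_tsum_le_tsum_norm (by rw [hcongr]; exact summable_norm_pairCoeff hg)
    _ = _ := by rw [hcongr]

/-- **Under RH every unit-slack weight is `Λ`-like in every smooth window**: `Δ_c` is bounded, by
`Σ_ρ m(ρ)|P_g(ρ)| + Re Φ_c(G) + ‖g‖₂²`. [folklore] -/
theorem bounded_discrepancy_of_riemannHypothesis (hRH : RiemannHypothesis) {c : ℕ → ℝ}
    (hU : ∀ φ : ℝ → ℂ, IsWeilTest φ →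
      -(∫ t, ‖φ t‖ ^ 2) ≤
        (weilPolarTerm (weilConv φ (weilReflect φ)) + weilArchTerm (weilConv φ (weilReflect φ)) -
          ∑' n : ℕ, ((c n : ℝ) : ℂ) / (Real.sqrt n : ℂ) *
            (weilConv φ (weilReflect φ) (Real.log n) + weilConv φ (weilReflect φ) (-Real.log n))).re)
    (hg : IsWeilTest g) (x : ℝ) :
    ‖∑' n : ℕ, (((c n - Λ n : ℝ)) : ℂ) / (Real.sqrt n : ℂ) *
        (weilTranslate (weilConv g (weilReflect g)) x (Real.log n) +
          weilTranslate (weilConv g (weilReflect g)) x (-Real.log n))‖ ≤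
      (∑' ρ : ZetaZeros.riemannZetaNontrivialZeros, ‖(riemannZetaZeroOrder (ρ : ℂ) : ℂ) * pairCoeff g ρ‖) +
        ((weilPolarTerm (weilConv g (weilReflect g)) + weilArchTerm (weilConv g (weilReflect g)) -
          (∑' n : ℕ, ((c n : ℝ) : ℂ) / (Real.sqrt n : ℂ) *
            (weilConv g (weilReflect g) (Real.log n) + weilConv g (weilReflect g) (-Real.log n))) +
          weilConv g (weilReflect g) 0).re + ∫ t, ‖g t‖ ^ 2) := by
  have h1 := norm_fakeDiscrepancy_sub_expSum_le hU hg x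
  have h2 := norm_expSum_le_of_riemannHypothesis hRH hg x
  have h3 := norm_le_insert'
    (∑' n : ℕ, (((c n - Λ n : ℝ)) : ℂ) / (Real.sqrt n : ℂ) *
        (weilTranslate (weilConv g (weilReflect g)) x (Real.log n) +
          weilTranslate (weilConv g (weilReflect g)) x (-Real.log n))) (expSum g x)
  linarith

/-- **Given a unit-slack weight, RH ⟺ it is `Λ`-like in every smooth window.**  For `c` with unit
slack against every Weil test: the Riemann hypothesis holds iff for every Weil test `g` the discrepancy
`Δ_c(x) = Σₙ (c(n) − Λ(n)) n^{-1/2}(G_x(log n) + G_x(−log n))` is bounded in `x`.  (So in the `¬RH` world of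
the open core an admissible weight must copy the unbounded off-line oscillation `B_g` in some window
family.) [folklore] -/
theorem riemannHypothesis_iff_bounded_discrepancy :
    ∀ c : ℕ → ℝ, (∀ φ : ℝ → ℂ, IsWeilTest φ →
      -(∫ t, ‖φ t‖ ^ 2) ≤
        (weilPolarTerm (weilConv φ (weilReflect φ)) + weilArchTerm (weilConv φ (weilReflect φ)) -
          ∑' n : ℕ, ((c n : ℝ) : ℂ) / (Real.sqrt n : ℂ) *
            (weilConv φ (weilReflect φ) (Real.log n) + weilConv φ (weilReflect φ) (-Real.log n))).re) →
    (RiemannHypothesis ↔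
      ∀ g : ℝ → ℂ, IsWeilTest g → ∃ C : ℝ, ∀ x : ℝ,
        ‖∑' n : ℕ, (((c n - ArithmeticFunction.vonMangoldt n : ℝ)) : ℂ) / (Real.sqrt n : ℂ) *
          (weilTranslate (weilConv g (weilReflect g)) x (Real.log n) +
            weilTranslate (weilConv g (weilReflect g)) x (-Real.log n))‖ ≤ C) :=
  fun _ hU ↦
  ⟨fun hRH _ hg ↦ ⟨_, fun x ↦ bounded_discrepancy_of_riemannHypothesis hRH hU hg x⟩,
    riemannHypothesis_of_unitSlack_of_bounded_discrepancy _ hU⟩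

end Summit.RiemannHypothesis.RiemannHypothesis.Theorems.SignConeConeMagnification

end
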